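import Summits.QuantumFields.BalabanUV.T4Continuum.Support.NE7K1LinTwoRunLower

/-!
# NE7K1LinTwoRunLines — row NE7 (node U5), candidate route HOM, path H1L, cell K1-lin(s): TWO-RUN COMPARISON AT `A = 0`,
# the STRAIGHT-LINE BOOKKEEPING for the sharp lower half — the `L^{d+1}` straight `L`-step lines through two adjacent blocks,
# the bond energy on the raw lattice, telescoping along a line, and the multiplicity count `Σ_X lineSum_μ(X) ≤ L·Σ_z bondE_μ(z)`

Lineage `b2b-balaban-t4-ne7-p2` (CRUX PROVER NE7 #2), generation 65; consumed by `NE7K1LinTwoRunJensen` (the sharp lower half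
`P_A ⪯ P_B^{Schur}` of the two-run comparability — lens 2's (K2)♯ supply `HOME/t4/ideate/NE7/lens2-g26/K2-SHARP-JENSEN-SUPPLY.md`,
graded SOUND at PRICING-NE7 v18 §111 (d), made kernel).  Objects of `NE7K1LinSchurLineU1` ∕ `B4Lower18`: `R′` a union of
`L`-blocks, `R = R′.image (blk L)`, chart points `rchart b j = Lb + j`, bonds `k : RBond R′` with end-points `k₋ = rsrc k`,
`k₊ = rtgt k = k₋ + e_μ`.  All [folklore]:

* §1 the straight line `linePt L x μ j m = Lx + j + m·e_μ`, `m = 0,…,L`, from the chart point of block `x` at offset `j` to the SAME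
  offset of block `x + e_μ` (`linePt_zero ∕ _succ ∕ _L`); its points are chart points of block `x` (`j_μ + m < L`,
  `linePt_eq_finePt_of_lt`) or of block `x + e_μ` (`linePt_eq_finePt_of_le`), hence lie in `R′` when both blocks do (`linePt_mem`).
* §2 the bond energy as a function on the raw lattice: `extZ` (zero extension), `bondE_μ(z) = (φ(z+e_μ) − φ(z))²·[z, z+e_μ ∈ R′]`,
  and **`sum_bondE`**: `Σ_{z∈R′}Σ_μ bondE_μ(z) = Σ_k(φ(k₊) − φ(k₋))²` (each bond of `RBond R′` once).
* §3 the LINE SUM `lineSum_μ(X) = Σ_jΣ_{m<L} bondE_μ(LX + j + m·e_μ)`; block sums through the chart (`blockSum_eq_sum_chart`);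
  **`line_telescope`**: `φ(LY + j) − φ(LX + j) = Σ_{m<L}(φ(LX+j+(m+1)e_μ) − φ(LX+j+m·e_μ))` for `Y = X + e_μ`.
* §4 **`sum_lineSum_le`**: `Σ_X lineSum_μ(X) ≤ L·Σ_{z∈R′} bondE_μ(z)` — the map `(X, j, m) ↦ (LX + j + m·e_μ, m)` is INJECTIVE, so
  every fine `μ`-bond is met at most once per `m < L`, i.e. at most `L` times over all lines of all blocks (this is the weighted
  count «`(r+1)∕L` from `(c,c+1)` plus `(L−1−r)∕L` from `(c−1,c)`, total ≤ 1» of lens 2's LEMMA W, done as one injection).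

HONEST FRAMING: lattice bookkeeping at `A = 0`, finite regions, [folklore]; nothing printed asserted; no `sorry`.  FIXED FINITE T⁴,
rung (B)+1; NE7 NOT PRINTED ∕ NOT PROVED; spine 0∕9; NOT infinite volume, NOT mass gap, NOT Clay.  HONEST DEPENDENCY: continuum YM on
T⁴ ⇐ BetaPertH ∧ nine spine estimates (0/9 proved); BetaPertH ⇐ (D1) ∧ (D4) ∧ CAP+tail; G-an2-4 gates asym, D1 and NE2/3/4.
-/

noncomputable section

open Finset Matrix

namespace Summit.QuantumFields.BalabanUV.T4Continuum.NE7K1LinTwoRunLines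

open Literature.MathematicalPhysics.QuantumFieldTheory.Balaban1983to89
open Literature.MathematicalPhysics.QuantumFieldTheory.Balaban1983to89.B4Reflection242
open Literature.MathematicalPhysics.QuantumFieldTheory.Balaban1983to89.B4BoxCov237
open Literature.MathematicalPhysics.QuantumFieldTheory.Balaban1983to89.B4Lower18
open Literature.MathematicalPhysics.QuantumFieldTheory.Balaban1983to89.B4Thm110ZeroBox (blk_blk)
open Literature.MathematicalPhysics.QuantumFieldTheory.Balaban1983to89.B4Green244 (finePt)
open NE7K1LinSchurLineForm NE7K1LinSchurLineCoords NE7K1LinBlockCoords NE7K1LinSchurLineU1 NE7K1LinTwoRunKit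
  NE7K1LinTwoRunUpper NE7K1LinTwoRunBonds NE7K1LinTwoRunLower

variable {d : ℕ}


/-! ### §1 Straight `L`-step lines through two adjacent blocks -/

section Line

variable {L : ℕ}

/-- the `m`-th point `Lx + j + m·e_μ` of the straight line in direction `μ` from the chart point of block `x` at offset `j`.
[folklore] -/
def linePt (L : ℕ) (x : Fin (d + 1) → ℤ) (μ : Fin (d + 1)) (j : Fin (d + 1) → Fin L) (m : ℕ) : Fin (d + 1) → ℤ :=
  finePt L x j + (m : ℤ) • uvec μ

/-- the line starts at the chart point. [folklore] -/
theorem linePt_zero (x : Fin (d + 1) → ℤ) (μ : Fin (d + 1)) (j : Fin (d + 1) → Fin L) : linePt L x μ j 0 = finePt L x j := by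
  simp [linePt]

/-- one step along the line is `+ e_μ`. [folklore] -/
theorem linePt_succ (x : Fin (d + 1) → ℤ) (μ : Fin (d + 1)) (j : Fin (d + 1) → Fin L) (m : ℕ) :
    linePt L x μ j (m + 1) = linePt L x μ j m + uvec μ := by
  simp only [linePt]
  push_cast
  rw [add_smul, one_smul, add_assoc]

/-- after `L` steps the line reaches the SAME offset of the next block `x + e_μ`. [folklore] -/
theorem linePt_L (x : Fin (d + 1) → ℤ) (μ : Fin (d + 1)) (j : Fin (d + 1) → Fin L) :
    linePt L x μ j L = finePt L (x + uvec μ) j := by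
  ext ν
  simp only [linePt, Pi.add_apply, Pi.smul_apply, smul_eq_mul, finePt_apply]
  ring

/-- below the face (`j_μ + m < L`) the line point is the chart point of block `x` at offset `j + m·e_μ`. [folklore] -/
theorem linePt_eq_finePt_of_lt (x : Fin (d + 1) → ℤ) (μ : Fin (d + 1)) (j : Fin (d + 1) → Fin L) (m : ℕ)
    (h : (j μ : ℕ) + m < L) :
    linePt L x μ j m = finePt L x (Function.update j μ ⟨(j μ : ℕ) + m, h⟩) := by
  ext ν
  by_cases hν : ν = μ
  · subst hν
    simp only [linePt, Pi.add_apply, Pi.smul_apply, smul_eq_mul, finePt_apply, uvec_apply_same, Function.update_self]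
    push_cast
    ring
  · simp only [linePt, Pi.add_apply, Pi.smul_apply, smul_eq_mul, finePt_apply, uvec_apply_ne hν, Function.update_of_ne hν,
      mul_zero, add_zero]

/-- above the face (`L ≤ j_μ + m`, `m ≤ L`) the line point is the chart point of block `x + e_μ` at offset `j + (m − L)·e_μ`.
[folklore] -/
theorem linePt_eq_finePt_of_le (x : Fin (d + 1) → ℤ) (μ : Fin (d + 1)) (j : Fin (d + 1) → Fin L) (m : ℕ)
    (h : L ≤ (j μ : ℕ) + m) (hm : m ≤ L) :
    linePt L x μ j m = finePt L (x + uvec μ)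
      (Function.update j μ ⟨(j μ : ℕ) + m - L, by have := (j μ).isLt; omega⟩) := by
  ext ν
  by_cases hν : ν = μ
  · subst hν
    simp only [linePt, Pi.add_apply, Pi.smul_apply, smul_eq_mul, finePt_apply, uvec_apply_same, Function.update_self]
    push_cast [Nat.cast_sub h]
    ring
  · simp only [linePt, Pi.add_apply, Pi.smul_apply, smul_eq_mul, finePt_apply, uvec_apply_ne hν, Function.update_of_ne hν,
      mul_zero, add_zero]

variable [NeZero L] {R' : Finset (Fin (d + 1) → ℤ)}

omit [NeZero L] in
/-- a lattice point whose `L`-block label lies in `R = R′.image (blk L)` lies in `R′` (block-union property). [folklore] -/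
theorem mem_of_blk_eq (hR'L : IsBlockUnion L R') (b : ↥(R'.image (blk L))) {z : Fin (d + 1) → ℤ} (hz : blk L z = b.1) :
    z ∈ R' := by
  obtain ⟨x, hx, hxb⟩ := Finset.mem_image.1 b.2
  exact hR'L hx (hz.trans hxb.symm)

/-- **THE LINE STAYS IN THE REGION**: for coarse sites `X`, `Y = X + e_μ` of `R` the whole line `LX + j + m·e_μ`, `m ≤ L`, lies in
`R′`. [folklore] -/
theorem linePt_mem (hR'L : IsBlockUnion L R') (X Y : ↥(R'.image (blk L))) {μ : Fin (d + 1)} (hY : Y.1 = X.1 + uvec μ)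
    (j : Fin (d + 1) → Fin L) {m : ℕ} (hm : m ≤ L) : linePt L X.1 μ j m ∈ R' := by
  have hL : 1 ≤ L := NeZero.one_le
  by_cases h : (j μ : ℕ) + m < L
  · rw [linePt_eq_finePt_of_lt X.1 μ j m h]
    exact mem_of_blk_eq hR'L X (blk_finePt hL X.1 _)
  · rw [linePt_eq_finePt_of_le X.1 μ j m (not_lt.1 h) hm, ← hY]
    exact mem_of_blk_eq hR'L Y (blk_finePt hL Y.1 _)

end Line

/-! ### §2 The bond energy as a function on the raw lattice -/

section Bond

variable (R' : Finset (Fin (d + 1) → ℤ))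

/-- the zero extension of a fine function to the whole lattice. [folklore] -/
def extZ (φ : ↥R' → ℝ) (z : Fin (d + 1) → ℤ) : ℝ := if h : z ∈ R' then φ ⟨z, h⟩ else 0

/-- on the region the extension is the function. [folklore] -/
theorem extZ_of_mem (φ : ↥R' → ℝ) {z : Fin (d + 1) → ℤ} (h : z ∈ R') : extZ R' φ z = φ ⟨z, h⟩ := by
  simp [extZ, h]

/-- the ENERGY OF THE `μ`-BOND AT `z`: `(φ(z + e_μ) − φ(z))²` if both ends lie in `R′`, else `0`. [folklore] -/
def bondE (φ : ↥R' → ℝ) (μ : Fin (d + 1)) (z : Fin (d + 1) → ℤ) : ℝ :=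
  if z ∈ R' ∧ z + uvec μ ∈ R' then (extZ R' φ (z + uvec μ) - extZ R' φ z) ^ 2 else 0

/-- bond energies are non-negative. [folklore] -/
theorem bondE_nonneg (φ : ↥R' → ℝ) (μ : Fin (d + 1)) (z : Fin (d + 1) → ℤ) : 0 ≤ bondE R' φ μ z := by
  unfold bondE
  split_ifs <;> positivity

/-- outside the region the bond energy vanishes. [folklore] -/
theorem bondE_eq_zero_of_not_mem (φ : ↥R' → ℝ) (μ : Fin (d + 1)) {z : Fin (d + 1) → ℤ} (h : z ∉ R') :
    bondE R' φ μ z = 0 := by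
  simp [bondE, h]

/-- **THE TOTAL BOND ENERGY, BOND BY BOND**: `Σ_{z∈R′}Σ_μ bondE_μ(z) = Σ_k(φ(k₊) − φ(k₋))²` over the bonds `k : RBond R′` (each
unordered nearest-neighbour bond of `R′` once, oriented `+e_μ`). [folklore] -/
theorem sum_bondE (φ : ↥R' → ℝ) :
    ∑ z : ↥R', ∑ μ, bondE R' φ μ z.1 = ∑ k : RBond R', (φ (rtgt k) - φ (rsrc k)) ^ 2 := by
  classical
  have h1 : ∑ k : RBond R', (φ (rtgt k) - φ (rsrc k)) ^ 2 =
      ∑ k : RBond R', bondE R' φ k.1.2 k.1.1.1 := by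
    refine Finset.sum_congr rfl fun k _ => ?_
    have hz : k.1.1.1 ∈ R' := k.1.1.2
    simp only [bondE, if_pos (And.intro hz k.2), extZ, dif_pos hz, dif_pos k.2]
    rfl
  rw [h1, ← Finset.sum_subtype (Finset.univ.filter fun p : ↥R' × Fin (d + 1) => p.1.1 + uvec p.2 ∈ R')
    (p := fun p : ↥R' × Fin (d + 1) => p.1.1 + uvec p.2 ∈ R') (fun p => by simp)
    (fun p : ↥R' × Fin (d + 1) => bondE R' φ p.2 p.1.1)]
  rw [Finset.sum_filter_of_ne, Fintype.sum_prod_type]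
  intro p _ hp
  by_contra h
  exact hp (by simp [bondE, h])

end Bond

/-! ### §3 Line sums and telescoping along one line -/

section Pair

variable {L : ℕ} [NeZero L] {R' : Finset (Fin (d + 1) → ℤ)}

/-- the LINE SUM of block `X` in direction `μ`: the bond energies met by the `L^{d+1}` straight lines `LX + j + m·e_μ`, `m < L`.
[folklore] -/
def lineSum (R' : Finset (Fin (d + 1) → ℤ)) (φ : ↥R' → ℝ) (μ : Fin (d + 1)) (X : ↥(R'.image (blk L))) : ℝ :=
  ∑ j : Fin (d + 1) → Fin L, ∑ m ∈ Finset.range L, bondE R' φ μ (linePt L X.1 μ j m)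

omit [NeZero L] in
/-- line sums are non-negative. [folklore] -/
theorem lineSum_nonneg (φ : ↥R' → ℝ) (μ : Fin (d + 1)) (X : ↥(R'.image (blk L))) : 0 ≤ lineSum R' φ μ X :=
  Finset.sum_nonneg fun _ _ => Finset.sum_nonneg fun _ _ => bondE_nonneg R' φ μ _

/-- a block sum is the sum over the chart. [folklore] -/
theorem blockSum_eq_sum_chart (hR'L : IsBlockUnion L R') (φ : ↥R' → ℝ) (b : ↥(R'.image (blk L))) :
    ∑ x' ∈ Finset.univ.filter (fun x' => rblk L R' x' = b), φ x' = ∑ j : Fin (d + 1) → Fin L, φ (rchart NeZero.one_le hR'L b j) := by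
  classical
  rw [filter_rblk_eq_image NeZero.one_le hR'L b,
    Finset.sum_image fun j _ j' _ h => rchart_injective NeZero.one_le hR'L b h]

/-- **TELESCOPING ALONG ONE LINE**: `φ(LY + j) − φ(LX + j) = Σ_{m<L}(φ(LX + j + (m+1)e_μ) − φ(LX + j + m·e_μ))` for
`Y = X + e_μ`. [folklore] -/
theorem line_telescope (hR'L : IsBlockUnion L R') (X Y : ↥(R'.image (blk L))) {μ : Fin (d + 1)} (hY : Y.1 = X.1 + uvec μ) (φ : ↥R' → ℝ)
    (j : Fin (d + 1) → Fin L) :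
    φ (rchart NeZero.one_le hR'L Y j) - φ (rchart NeZero.one_le hR'L X j) =
      ∑ m ∈ Finset.range L, (extZ R' φ (linePt L X.1 μ j (m + 1)) - extZ R' φ (linePt L X.1 μ j m)) := by
  have key : ∑ m ∈ Finset.range L, (extZ R' φ (linePt L X.1 μ j (m + 1)) - extZ R' φ (linePt L X.1 μ j m)) =
      extZ R' φ (linePt L X.1 μ j L) - extZ R' φ (linePt L X.1 μ j 0) :=
    Finset.sum_range_sub (fun m => extZ R' φ (linePt L X.1 μ j m)) L
  have h0 : extZ R' φ (linePt L X.1 μ j 0) = φ (rchart NeZero.one_le hR'L X j) := by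
    rw [extZ_of_mem R' φ (linePt_mem hR'L X Y hY j (Nat.zero_le L))]
    congr 1
    exact Subtype.ext (linePt_zero X.1 μ j)
  have hL' : extZ R' φ (linePt L X.1 μ j L) = φ (rchart NeZero.one_le hR'L Y j) := by
    rw [extZ_of_mem R' φ (linePt_mem hR'L X Y hY j le_rfl)]
    congr 1
    apply Subtype.ext
    show linePt L X.1 μ j L = finePt L Y.1 j
    rw [linePt_L, ← hY]
  rw [key, h0, hL']

/-! ### §4 The count: every fine bond is met by at most `L` of the lines, summed over all blocks -/

/-- **THE MULTIPLICITY COUNT**: `Σ_X lineSum_μ(X) ≤ L·Σ_{z∈R′} bondE_μ(z)` — the map `(X, j, m) ↦ (LX + j + m·e_μ, m)` is injective,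
so each fine `μ`-bond is met at most once for each `m < L`. [folklore] -/
theorem sum_lineSum_le (φ : ↥R' → ℝ) (μ : Fin (d + 1)) :
    ∑ X : ↥(R'.image (blk L)), lineSum R' φ μ X ≤ (L : ℝ) * ∑ z : ↥R', bondE R' φ μ z.1 := by
  classical
  have hL : 1 ≤ L := NeZero.one_le
  set D : Finset (↥(R'.image (blk L)) × ((Fin (d + 1) → Fin L) × ℕ)) :=
    (Finset.univ : Finset ↥(R'.image (blk L))) ×ˢ ((Finset.univ : Finset (Fin (d + 1) → Fin L)) ×ˢ Finset.range L) with hD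
  set F : ↥(R'.image (blk L)) × ((Fin (d + 1) → Fin L) × ℕ) → (Fin (d + 1) → ℤ) × ℕ :=
    fun p => (linePt L p.1.1 μ p.2.1 p.2.2, p.2.2) with hF
  -- injectivity
  have hinj : Set.InjOn F ↑D := by
    rintro ⟨X, j, m⟩ _ ⟨X', j', m'⟩ _ h
    simp only [hF, Prod.mk.injEq] at h
    obtain ⟨hpt, hm⟩ := h
    subst hm
    have hfp : finePt L X.1 j = finePt L X'.1 j' := by
      have h2 : finePt L X.1 j + (m : ℤ) • uvec μ = finePt L X'.1 j' + (m : ℤ) • uvec μ := hpt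
      exact add_right_cancel h2
    have hX : X = X' := by
      apply Subtype.ext
      have h3 := congrArg (blk L) hfp
      rwa [blk_finePt hL, blk_finePt hL] at h3
    subst hX
    have hj : j = j' := finePt_injective L X.1 hfp
    subst hj
    rfl
  -- the left side as a sum over `D`
  have hlhs : ∑ X : ↥(R'.image (blk L)), lineSum R' φ μ X = ∑ p ∈ D, bondE R' φ μ (F p).1 := by
    rw [hD, Finset.sum_product]
    refine Finset.sum_congr rfl fun X _ => ?_
    rw [Finset.sum_product]
    rfl
  rw [hlhs, ← Finset.sum_image (f := fun q : (Fin (d + 1) → ℤ) × ℕ => bondE R' φ μ q.1) hinj,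
    ← Finset.sum_filter_ne_zero (D.image F)]
  -- the non-zero terms lie in `R′ × {0,…,L−1}`
  have hsub : (D.image F).filter (fun q => bondE R' φ μ q.1 ≠ 0) ⊆ R' ×ˢ Finset.range L := by
    intro q hq
    rw [Finset.mem_filter, Finset.mem_image] at hq
    obtain ⟨⟨p, hp, hpq⟩, hne⟩ := hq
    rw [Finset.mem_product]
    refine ⟨?_, ?_⟩
    · by_contra h
      exact hne (bondE_eq_zero_of_not_mem R' φ μ h)
    · rw [← hpq]
      have hp2 : p.2.2 ∈ Finset.range L := by
        rw [hD, Finset.mem_product, Finset.mem_product] at hp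
        exact hp.2.2
      exact hp2
  refine (Finset.sum_le_sum_of_subset_of_nonneg hsub fun q _ _ => bondE_nonneg R' φ μ q.1).trans (le_of_eq ?_)
  rw [Finset.sum_product, Finset.mul_sum, ← Finset.sum_coe_sort R']
  refine Finset.sum_congr rfl fun z _ => ?_
  show ∑ _m ∈ Finset.range L, bondE R' φ μ z.1 = _
  rw [Finset.sum_const, Finset.card_range, nsmul_eq_mul]

end Pair

end Summit.QuantumFields.BalabanUV.T4Continuum.NE7K1LinTwoRunLines
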